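import Summits.CriticalPhenomena.PercolationContinuityZ3.Theorems.Transplant.HexShadowTransport
import Literature.Probability.Percolation.SlabCriticalityInputs
import HarnessLib

/-!
# HEXAGONAL SHADOWS III — the coarse lattice `c + 4n·ℤ²`, the good-edge configuration, its measurability, translation invariance and
# `5`-dependence (towards NODE B, the renormalisation step of Duminil-Copin–Sidoravicius–Tassion §2.2)

builds on p205010 (kernel theorem, internal audit signed; external expert review pending) — NOT used in this file.
Lane `prim-bschramm`, seat `prim-bschramm-p2` (gen 31; class C1b; memo `HOME/bschramm/P2-LATTICES.md` §110); helper file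
(`--supports stmt-CriticalPhenomena-4575 --as helper`).  Interface `Transplant/HexShadowDefs`, tools `Transplant/HexShadowTransport`; slab original
`Literature/…/SlabCriticalityInputs` ll. 135–545 (`coarsePt`, `coarseConfig`, `measurable_coarseConfig`, `real_goodEvent_shift`, `coarseRegion`,
`determinedBy_preimage_coarseConfig`, `disjoint_coarseRegion`).

Coarse vertices `x ∈ ℤ²` sit at `c + 4n·x ∈ 𝕋` (`coarsePt`); the GOOD-EDGE CONFIGURATION `coarseConfig n u ω ⊆ E(ℤ²)` collects the coarse edges
`{x, x+eᵢ}` whose good event `Φ.goodEvent n u (c + 4n x) i` occurs; it is a measurable function of `ω`; every coarse edge is good with the probability of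
the centre edge of the same direction (`real_goodEvent_coarsePt`, `period ∣ n`); coarse edges at sup-distance `≥ 5` depend on DISJOINT sets of edges of
`G` (their regions `hexBall (· + 2n eᵢ) 6n` have centres `≥ 16n` apart in `triNorm` for radius `6n`: `disjoint_coarseRegion`, via the homogeneity
`triNorm_natMul` and the triangle inequality in distance form).
[cite: DuminilCopinSidoraviciusTassion2016, §2.2 (arXiv p. 9)] [cite: GrimmettPercolation1999, §1.6 p. 16]
-/

noncomputable section

namespace Summit.CriticalPhenomena.PercolationContinuityZ3.Theorems.Transplant

open MeasureTheory Literature.Probability.Percolation Literature.Probability.LatticeModels SimpleGraph Filter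
open scoped Classical

/-! ## §1 More hexagonal geometry: homogeneity and the triangle inequality in distance form -/

/-- Homogeneity of `triNorm` under natural multiples. [folklore] -/
theorem triNorm_natMul (m : ℕ) (v : Site 2) : triNorm ((m : ℤ) • v) = m * triNorm v := by
  simp only [triNorm, Pi.smul_apply, smul_eq_mul, ← mul_add, abs_mul, Nat.abs_cast]
  have hm : (0 : ℤ) ≤ m := Nat.cast_nonneg m
  rw [← mul_max_of_nonneg _ _ hm, ← mul_max_of_nonneg _ _ hm]

/-- The triangle inequality for `triNorm` in distance form: `|u − w| ≤ |u − v| + |v − w|` (private copy: the statement exists in an unrelated crux file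
of another summit, which is not imported). [folklore] -/
private theorem triNorm_sub_le_triNorm_sub_add (u v w : Site 2) : triNorm (u - w) ≤ triNorm (u - v) + triNorm (v - w) := by
  simp only [triNorm, Pi.sub_apply, max_le_iff]
  have l0 := (abs_le_triNorm (u - v)).1; have l1 := (abs_le_triNorm (u - v)).2
  have l2 : |(u - v) 0 + (u - v) 1| ≤ triNorm (u - v) := (le_max_right _ _).trans (le_max_right _ _)
  have m0 := (abs_le_triNorm (v - w)).1; have m1 := (abs_le_triNorm (v - w)).2
  have m2 : |(v - w) 0 + (v - w) 1| ≤ triNorm (v - w) := (le_max_right _ _).trans (le_max_right _ _)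
  simp only [triNorm, Pi.sub_apply] at l0 l1 l2 m0 m1 m2 ⊢
  rw [abs_le] at l0 l1 l2 m0 m1 m2
  refine ⟨abs_le.2 ⟨?_, ?_⟩, abs_le.2 ⟨?_, ?_⟩, abs_le.2 ⟨?_, ?_⟩⟩ <;> linarith

/-- The sup norm is bounded by `triNorm`: a point outside the sup-box of radius `M` has `triNorm > M`. [folklore] -/
theorem lt_triNorm_of_notMem_box {M : ℕ} {y : Site 2} (hy : y ∉ box 2 M) : (M : ℤ) < triNorm y := by
  simp only [mem_box, not_forall, not_and_or, not_le] at hy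
  obtain ⟨j, hj⟩ := hy
  have hyj : (M : ℤ) < |y j| := by
    rcases hj with hj | hj
    · rw [lt_abs]; right; linarith
    · rw [lt_abs]; left; linarith
  have hle : |y j| ≤ triNorm y := by
    fin_cases j
    · exact (abs_le_triNorm y).1
    · exact (abs_le_triNorm y).2
  exact hyj.trans_le hle

/-- The unit directions of `𝕋` have `triNorm` one, and so `triNorm (m • eᵢ) = m`. [folklore] -/
theorem triNorm_natMul_single (m : ℕ) (i : Fin 2) : triNorm ((m : ℤ) • (Pi.single i 1 : Site 2)) = m := by
  rw [triNorm_natMul]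
  have : triNorm (Pi.single i (1 : ℤ) : Site 2) = 1 := by fin_cases i <;> simp [triNorm]
  rw [this, mul_one]

namespace HexShadow

variable {V : Type} {G : SimpleGraph V} (Φ : HexShadow G)

/-! ## §2 The coarse lattice `c + 4n·ℤ²` and the good-edge configuration -/

/-- The base point `c + 4n·x ∈ 𝕋` of the coarse vertex `x ∈ ℤ²`. [cite: DuminilCopinSidoraviciusTassion2016, §2.2] -/
def coarsePt (n : ℕ) (x : Site 2) : Site 2 := Φ.centre + ((4 * n : ℕ) : ℤ) • x

/-- `coarsePt` of a coarse neighbour: `c + 4n(x + eᵢ) = (c + 4n x) + 4n eᵢ`. [folklore] -/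
theorem coarsePt_add_single (n : ℕ) (x : Site 2) (i : Fin 2) :
    Φ.coarsePt n (x + Pi.single i 1) = Φ.coarsePt n x + (4 * (n : ℤ)) • Pi.single i 1 := by
  simp only [coarsePt, smul_add]; push_cast; abel

/-- `coarsePt n 0 = c`. [folklore] -/
@[simp] theorem coarsePt_zero (n : ℕ) : Φ.coarsePt n 0 = Φ.centre := by simp [coarsePt]

/-- **The good-edge configuration**: the nearest-neighbour edges `{x, x + eᵢ}` of the coarse lattice `ℤ²` whose good-edge event at `c + 4n x` occurs.
[cite: DuminilCopinSidoraviciusTassion2016, §2.2 ("Call an edge {z,z'} of 4nℤ² good if …")] -/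
def coarseConfig (n u : ℕ) (ω : BondConfig V) : BondConfig (Site 2) :=
  {e | ∃ (x : Site 2) (i : Fin 2), e = s(x, x + Pi.single i 1) ∧ ω ∈ Φ.goodEvent n u (Φ.coarsePt n x) i}

/-- Membership of a coarse edge in the good-edge configuration. [cite: DuminilCopinSidoraviciusTassion2016, §2.2] -/
theorem mk_mem_coarseConfig_iff (n u : ℕ) (ω : BondConfig V) (x : Site 2) (i : Fin 2) :
    s(x, x + Pi.single i 1) ∈ Φ.coarseConfig n u ω ↔ ω ∈ Φ.goodEvent n u (Φ.coarsePt n x) i := by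
  constructor
  · rintro ⟨x', j, he, hg⟩
    obtain ⟨rfl, rfl⟩ := (coarseEdge_eq_iff x x' i j).1 he
    exact hg
  · intro h
    exact ⟨x, i, rfl, h⟩

/-- The good-edge event is measurable. [cite: DuminilCopinSidoraviciusTassion2016, §2.2] -/
theorem measurableSet_goodEvent (n u : ℕ) (z : Site 2) (i : Fin 2) : MeasurableSet (Φ.goodEvent n u z i) :=
  measurableSet_of_isLocalEvent_holds (Φ.isLocalEvent_goodEvent n u z i)

/-- The good-edge configuration is a measurable function of the configuration of `G`. [cite: DuminilCopinSidoraviciusTassion2016, §2.2] -/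
theorem measurable_coarseConfig (n u : ℕ) : Measurable (Φ.coarseConfig n u) := by
  refine measurable_set_iff.2 fun e => ?_
  refine measurableSet_setOf.1 ?_
  have : {ω : BondConfig V | e ∈ Φ.coarseConfig n u ω} =
      ⋃ x : Site 2, ⋃ i : Fin 2, {ω | e = s(x, x + Pi.single i 1) ∧ ω ∈ Φ.goodEvent n u (Φ.coarsePt n x) i} := by
    ext ω
    simp only [coarseConfig, Set.mem_setOf_eq, Set.mem_iUnion]
  rw [this]
  refine MeasurableSet.iUnion fun x => MeasurableSet.iUnion fun i => ?_
  by_cases he : e = s(x, x + Pi.single i 1)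
  · simp only [he, true_and]
    exact Φ.measurableSet_goodEvent n u _ i
  · simp only [he, false_and, Set.setOf_false]
    exact MeasurableSet.empty

/-- **Every coarse edge of direction `i` is good with the probability of the centre edge of direction `i`** (`period ∣ n`).
[cite: DuminilCopinSidoraviciusTassion2016, §2.2 ("the probability to be good")] -/
theorem real_goodEvent_coarsePt [Countable V] (p : unitInterval) {n : ℕ} (hdvd : Φ.period ∣ n) (u : ℕ) (x : Site 2) (i : Fin 2) :
    (bondPercolation G p).real (Φ.goodEvent n u (Φ.coarsePt n x) i) = (bondPercolation G p).real (Φ.goodEvent n u Φ.centre i) := by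
  obtain ⟨m, hm⟩ := hdvd
  have e : Φ.coarsePt n x = Φ.centre + (Φ.period : ℤ) • ((4 * (m : ℤ)) • x) := by
    simp only [coarsePt, hm, smul_smul]; push_cast; ring_nf
  rw [e, Φ.real_goodEvent_shift]

/-! ## §3 `5`-dependence: far coarse edges depend on disjoint sets of edges of `G` -/

/-- The edges of `G` on which the state of the coarse edge `e` depends: for `e = {x, x + eᵢ}`, the edges over the region `hexBall (c + 4n x + 2n eᵢ) 6n`
(none for other pairs). [cite: DuminilCopinSidoraviciusTassion2016, §2.2] -/
def coarseRegion (n : ℕ) (e : Sym2 (Site 2)) : Set (Sym2 V) :=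
  {d | ∃ (x : Site 2) (i : Fin 2), e = s(x, x + Pi.single i 1) ∧
    d ∈ Set.sym2 (Φ.lift (hexBall (Φ.coarsePt n x + (2 * (n : ℤ)) • Pi.single i 1) (6 * n)))}

/-- Events of the coarse configuration determined by the coarse edges in `F` pull back to events determined by the edges of `G` in
`⋃_{e ∈ F} coarseRegion e`. [cite: DuminilCopinSidoraviciusTassion2016, §2.2 ("being good depends only on the state of the edges in a finite box")] -/
theorem determinedBy_preimage_coarseConfig (n u : ℕ) {A : Set (BondConfig (Site 2))} {F : Finset (Sym2 (Site 2))}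
    (hA : DeterminedBy A (↑F : Set (Sym2 (Site 2)))) : DeterminedBy (Φ.coarseConfig n u ⁻¹' A) (⋃ e ∈ F, Φ.coarseRegion n e) := by
  rw [determinedBy_iff] at hA ⊢
  intro ω ω' h
  have key : ∀ e ∈ F, (e ∈ Φ.coarseConfig n u ω ↔ e ∈ Φ.coarseConfig n u ω') := by
    intro e he
    simp only [coarseConfig, Set.mem_setOf_eq]
    refine exists_congr fun x => exists_congr fun i => and_congr_right fun hex => ?_
    refine (determinedBy_iff _ _).1 (Φ.determinedBy_goodEvent n u (Φ.coarsePt n x) i) ω ω' ?_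
    set R := Set.sym2 (Φ.lift (hexBall (Φ.coarsePt n x + (2 * (n : ℤ)) • Pi.single i 1) (6 * n))) with hR
    have hsub : R ⊆ ⋃ e ∈ F, Φ.coarseRegion n e := fun d hd => Set.mem_biUnion (Finset.mem_coe.2 he) ⟨x, i, hex, hd⟩
    calc ω ∩ R = (ω ∩ ⋃ e ∈ F, Φ.coarseRegion n e) ∩ R := by rw [Set.inter_assoc, Set.inter_eq_right.2 hsub]
      _ = (ω' ∩ ⋃ e ∈ F, Φ.coarseRegion n e) ∩ R := by rw [h]
      _ = ω' ∩ R := by rw [Set.inter_assoc, Set.inter_eq_right.2 hsub]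
  simp only [Set.mem_preimage]
  apply hA
  ext e
  simp only [Set.mem_inter_iff, Finset.mem_coe]
  constructor
  · rintro ⟨h1, h2⟩; exact ⟨(key e h2).1 h1, h2⟩
  · rintro ⟨h1, h2⟩; exact ⟨(key e h2).2 h1, h2⟩

/-- **`5`-dependence** (`n ≥ 1`): coarse edges whose vertices are at sup-distance `≥ 5` depend on disjoint sets of edges of `G` (their regions
have `triNorm`-radius `6n` about centres `≥ 4n·5 − 4n = 16n` apart). [cite: DuminilCopinSidoraviciusTassion2016, §2.2 ("4-dependent")] -/
theorem disjoint_coarseRegion {n : ℕ} (hn : 1 ≤ n) {F₁ F₂ : Finset (Sym2 (Site 2))}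
    (hfar : ∀ e₁ ∈ F₁, ∀ e₂ ∈ F₂, ∀ a ∈ e₁, ∀ b ∈ e₂, (5 : ℤ) ≤ max |a 0 - b 0| |a 1 - b 1|) :
    Disjoint (⋃ e ∈ F₁, Φ.coarseRegion n e) (⋃ e ∈ F₂, Φ.coarseRegion n e) := by
  rw [Set.disjoint_left]
  intro d hd1 hd2
  simp only [Set.mem_iUnion, coarseRegion, Set.mem_setOf_eq, exists_prop] at hd1 hd2
  obtain ⟨e₁, he₁, x₁, i₁, hex₁, hd₁⟩ := hd1
  obtain ⟨e₂, he₂, x₂, i₂, hex₂, hd₂⟩ := hd2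
  have h5 := hfar e₁ he₁ e₂ he₂ x₁ (by rw [hex₁]; exact Sym2.mem_mk_left _ _) x₂ (by rw [hex₂]; exact Sym2.mem_mk_left _ _)
  obtain ⟨v, hv⟩ : ∃ v, v ∈ d := ⟨d.out.1, Sym2.out_fst_mem d⟩
  have hv₁ := Set.mem_sym2_iff_subset.1 hd₁ hv
  have hv₂ := Set.mem_sym2_iff_subset.1 hd₂ hv
  rw [mem_lift, mem_hexBall] at hv₁ hv₂
  have nsymm : ∀ u w : Site 2, triNorm (u - w) = triNorm (w - u) := fun u w => by
    rw [show u - w = -(w - u) by abel]; simp only [triNorm, Pi.neg_apply, ← neg_add, abs_neg]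
  set c₁ := Φ.coarsePt n x₁ + (2 * (n : ℤ)) • (Pi.single i₁ 1 : Site 2) with hc₁
  set c₂ := Φ.coarsePt n x₂ + (2 * (n : ℤ)) • (Pi.single i₂ 1 : Site 2) with hc₂
  -- the two region centres are within `12n` of each other through `sh v` …
  have hnear : triNorm (c₁ - c₂) ≤ 12 * n := by
    have t := triNorm_sub_le_triNorm_sub_add c₁ (Φ.sh v) c₂
    rw [nsymm c₁ (Φ.sh v)] at t; push_cast at hv₁ hv₂; linarith
  -- … but `c₁ − c₂ = 4n(x₁ − x₂) − (2n e_{i₂} − 2n e_{i₁})` has `triNorm ≥ 20n − 4n`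
  have hx : (5 : ℤ) ≤ triNorm (x₁ - x₂) := by
    rcases le_max_iff.1 h5 with h | h
    · exact h.trans (abs_le_triNorm (x₁ - x₂)).1
    · exact h.trans (abs_le_triNorm (x₁ - x₂)).2
  set A : Site 2 := ((4 * n : ℕ) : ℤ) • (x₁ - x₂) with hA
  set E : Site 2 := ((2 * n : ℕ) : ℤ) • (Pi.single i₂ 1 : Site 2) - ((2 * n : ℕ) : ℤ) • Pi.single i₁ 1 with hE
  have hAD : A - (c₁ - c₂) = E := by
    simp only [hA, hE, hc₁, hc₂, coarsePt, smul_sub]; push_cast; abel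
  have hA' : triNorm A = (4 * n : ℕ) * triNorm (x₁ - x₂) := by rw [hA, triNorm_natMul]
  have hE' : triNorm E ≤ 4 * n := by
    have t := triNorm_sub_le_triNorm_sub_add (((2 * n : ℕ) : ℤ) • (Pi.single i₂ 1 : Site 2)) 0 (((2 * n : ℕ) : ℤ) • Pi.single i₁ 1)
    rw [sub_zero, triNorm_natMul_single, nsymm 0, sub_zero, triNorm_natMul_single] at t
    rw [hE]; push_cast at t ⊢; linarith
  have hfar' : 16 * (n : ℤ) ≤ triNorm (c₁ - c₂) := by
    have t := triNorm_sub_le_triNorm_sub_add A (c₁ - c₂) 0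
    rw [sub_zero, hAD, sub_zero] at t
    have h20 : 20 * (n : ℤ) ≤ triNorm A := by rw [hA']; push_cast; nlinarith [hx, Nat.cast_nonneg (α := ℤ) n]
    linarith
  have : (n : ℤ) ≥ 1 := by exact_mod_cast hn
  linarith

end HexShadow

end Summit.CriticalPhenomena.PercolationContinuityZ3.Theorems.Transplant

end
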